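import Summits.QuantumAdvantage.AdviceFreeQNC0.BondTwist
import Summits.QuantumAdvantage.AdviceFreeQNC0.LinFormsRegular
import Mathlib.Analysis.InnerProductSpace.Basic
import HarnessLib

/-!
# Cell qa-qnc0, `p = 3` — the bond-twisted REGISTER CHAIN for local bell rules (planner qa-qnc0-p1 g20, ask P-20e;
ROUND-19 §3; `exp20/Sketch20x.lean` §6–§8, definitions VERBATIM)

Typed targets of the next rung (R-lin3 ⊗ R-loc): `CycNear`, `IsLocalRule`, `TwistBoundX3Local`, `RingWindowLocalLt3`,
`RingLinFormsLocalLt3` (§6), the register chain `RegState`, `shiftIn`, `nextState`, `siteOpR`, `rnsq`, `blockOpR` (§7) and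
the quantitative statements `BlockNormUniform3`, `TwistBoundX3LocalQ`, `RingWindowLocalPolyLt3`, `RingLinFormsLocalPolyLt3`,
`RingAffineBellsLt3` (§8–§9) — so that planners and provers share importable names.

PROVED here (P-20e stub 1 and the equality case the block lemma needs):
* `nextState_lostBit_injective` — `(σ, b) ↦ (nextState σ b, forgotten bit)` is a bijection of `RegState r × Bool`, so
  `∑_σ (g (nextState σ 0) + g (nextState σ 1)) = 2 ∑_τ g τ` (`sum_nextState`);
* `rnsq_siteOpR_add_defect_le` — `‖T f‖² + ¼ Σ_σ ‖s₀f(n₀σ) − ζ s₁ f(n₁σ)‖² ≤ ‖f‖²` (parallelogram identity), whence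
  **`rnsq_siteOpR_le`** (every site operator is an `ℓ²`-contraction, `‖ζ‖ ≤ 1`) and
  **`siteOpR_aligned_of_rnsq_eq`** (norm equality forces the ALIGNMENT `s₀ f(n₀σ) = ζ s₁ f(n₁σ)` at every state).

WHAT THIS IS NOT: the block lemma `blockOpR_contracts` is in `BlockLemma.lean`; no strategy bound here; crux 22907 untouched;
separation NOT moved.
-/

namespace Summit.QuantumAdvantage.AdviceFreeQNC0

open Finset Literature.Computability.QuantumComplexity

namespace BondTwist3

/-! ## §6 Local bell rules and the typed rung (Sketch20x §6, verbatim) -/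

/-- `cycDist N j k ≤ r`: cyclic distance on `Fin N`, spelled out as in `Fib19.RingLocalLt3`. -/
def CycNear (N r : ℕ) (j k : Fin N) : Prop :=
  (j.val + N - k.val) % N ≤ r ∨ (k.val + N - j.val) % N ≤ r

/-- A cut-indexed bit rule `t k x` is `r`-LOCAL if `t k x` depends only on `x` restricted to the cyclic window of radius
`r` at `k`. -/
def IsLocalRule (N r : ℕ) (t : Fin N → (Fin N → Bool) → Bool) : Prop :=
  ∀ (x x' : Fin N → Bool) (k : Fin N), (∀ j : Fin N, CycNear N r j k → x j = x' j) → t k x = t k x'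

/-- **`TwistBoundX3Local`** (block version of `TwistBoundX3`, ROUND-19 §3): for bells given by an `r`-LOCAL rule (in the
`tGuess` frame) the bond-twisted WIN-sum decays exponentially in `#supp γ`, at a rate depending on `r` only. -/
def TwistBoundX3Local : Prop :=
  open scoped Classical in
  ∀ r : ℕ, ∃ A ρ : ℝ, ρ < 1 ∧ ∀ (N : ℕ) (t : Fin N → (Fin N → Bool) → Bool), IsLocalRule N r t →
    ∀ γ : Fin N → ZMod 3,
      ‖∑ x : Fin N → Bool,
          (ZMod.stdAddChar (∑ i : Fin N, if x i then γ i else 0) : ℂ) *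
            (if (OddZeros x ∧ RingHLF.Rel x (fun k => xor (tGuess x k) (t k x))) then (1 : ℂ) else 0)‖
        ≤ A * ρ ^ (univ.filter fun i : Fin N => γ i ≠ 0).card * (2 : ℝ) ^ N

/-- **Support `RingWindowLocalLt3`**: bells that are `r`-local inside a window of length `≥ L₀` and otherwise measurable
w.r.t. the bits outside it win on `≤ θ₀·2^{N−1}`, `θ₀ = θ₀(r) < 1`. -/
def RingWindowLocalLt3 : Prop :=
  open scoped Classical in
  ∀ r : ℕ, ∃ θ₀ : ℝ, θ₀ < 1 ∧ ∃ L₀ : ℕ, ∀ (N a L : ℕ), L₀ ≤ L → a + L ≤ N →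
    ∀ t : Fin N → (Fin N → Bool) → Bool,
      (∀ (x x' : Fin N → Bool) (k : Fin N),
          (∀ j : Fin N, (j.val < a ∨ a + L ≤ j.val) ∨ CycNear N r j k → x j = x' j) → t k x = t k x') →
        ((univ.filter fun x : Fin N → Bool =>
            OddZeros x ∧ RingHLF.Rel x (fun k => xor (tGuess x k) (t k x))).card : ℝ)
          ≤ θ₀ * (2 : ℝ) ^ (N - 1)

/-- **RUNG CANDIDATE `RingLinFormsLocalLt3`** (R-lin3 ⊗ R-loc, constant radius): bells = per-cut tables of
`K ≤ (log₂ N)^C` linear forms of `x` mod 3 AND the radius-`r` window at the cut. -/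
def RingLinFormsLocalLt3 : Prop :=
  open scoped Classical in
  ∀ r : ℕ, ∃ θ : ℝ, θ < 1 ∧ ∀ C : ℕ, ∃ n₀ : ℕ, ∀ N ≥ n₀, ∀ K ≤ Nat.log 2 N ^ C,
    ∀ (lam : Fin K → Fin N → ZMod 3) (tab : Fin N → (Fin K → ZMod 3) → (Fin N → Bool) → Bool),
      (∀ v : Fin K → ZMod 3, IsLocalRule N r (fun k x => tab k v x)) →
        ((univ.filter fun x : Fin N → Bool =>
            OddZeros x ∧ RingHLF.Rel x (fun k => xor (tGuess x k) (tab k (LinForms.resVec lam x) x))).card : ℝ)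
          ≤ θ * (2 : ℝ) ^ (N - 1)

/-! ## §7 The register chain (Sketch20x §7, verbatim) -/

/-- Register-chain state: walk position mod 3, previous spin, last `2r` bits (index `0` = oldest). -/
abbrev RegState (r : ℕ) := ZMod 3 × Bool × (Fin (2 * r) → Bool)

/-- Shift a new bit into the register (drop the oldest). -/
def shiftIn {m : ℕ} (reg : Fin m → Bool) (b : Bool) : Fin m → Bool :=
  fun j => if h : j.val + 1 < m then reg ⟨j.val + 1, h⟩ else b

/-- Deterministic update on reading bit `b`: spin kept iff `b = true`, position moves by the NEW spin, register shifts. -/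
def nextState {r : ℕ} (σ : RegState r) (b : Bool) : RegState r :=
  let s' := if b then σ.2.1 else !σ.2.1
  (σ.1 + spinZ s', s', shiftIn σ.2.2 b)

/-- Site operator (backward transfer) with bond phase `ζ` on the `b = true` branch and sign pattern `ε`
(`true` = sign `−1`). -/
noncomputable def siteOpR {r : ℕ} (ζ : ℂ) (ε : RegState r → Bool → Bool) (f : RegState r → ℂ) : RegState r → ℂ :=
  fun σ => ((if ε σ false then (-1 : ℂ) else 1) * f (nextState σ false)
            + ζ * (if ε σ true then (-1 : ℂ) else 1) * f (nextState σ true)) / 2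

/-- Squared `ℓ²` norm for the uniform law on `RegState r` (unnormalised). -/
noncomputable def rnsq {r : ℕ} (f : RegState r → ℂ) : ℝ := ∑ σ, ‖f σ‖ ^ 2

/-- The block operator `T_i ∘ T_{i+1} ∘ ⋯ ∘ T_{i+2r}`: first site phase `ζ`, later sites phases `ω j`, signs `ε j`. -/
noncomputable def blockOpR {r : ℕ} (ζ : ℂ) (ω : Fin (2 * r) → ℂ) (ε : Fin (2 * r + 1) → RegState r → Bool → Bool)
    (f : RegState r → ℂ) : RegState r → ℂ :=
  siteOpR ζ (ε 0) (List.foldr (fun (p : ℂ × (RegState r → Bool → Bool)) g => siteOpR p.1 p.2 g) f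
    (List.ofFn fun j : Fin (2 * r) => (ω j, ε j.succ)))

/-! ## §7′ The site operator is an `ℓ²`-contraction; equality forces alignment (PROVED) -/

variable {r : ℕ}

/-- The bit forgotten by `nextState`: the oldest register bit (the bit read, when `r = 0`). -/
def lostBit (σ : RegState r) (b : Bool) : Bool :=
  if h : 0 < 2 * r then σ.2.2 ⟨0, h⟩ else b

/-- `(σ, b) ↦ (nextState σ b, lostBit σ b)` is injective (hence a bijection of the finite type `RegState r × Bool`). -/
theorem nextState_lostBit_injective :
    Function.Injective fun σb : RegState r × Bool => (nextState σb.1 σb.2, lostBit σb.1 σb.2) := by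
  rintro ⟨⟨P, s, reg⟩, b⟩ ⟨⟨P', s', reg'⟩, b'⟩ h
  simp only [nextState, lostBit, Prod.mk.injEq] at h
  obtain ⟨⟨hP, hs, hreg⟩, hl⟩ := h
  have hb : b = b' := by
    by_cases hm : 0 < 2 * r
    · have e := congrFun hreg ⟨2 * r - 1, by omega⟩
      have hlt : ¬ (2 * r - 1 + 1 < 2 * r) := by omega
      simpa [shiftIn, hlt] using e
    · simpa [hm] using hl
  subst hb
  have hss : s = s' := by cases b <;> simpa using hs
  subst hss
  have hP' : P = P' := add_right_cancel hP
  have hreg' : reg = reg' := by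
    funext j
    by_cases hj : j.val = 0
    · have hm : 0 < 2 * r := by omega
      have hj' : j = ⟨0, hm⟩ := Fin.ext hj
      simp only [hm, dite_true] at hl
      rw [hj']; exact hl
    · have e := congrFun hreg ⟨j.val - 1, by omega⟩
      have hlt : j.val - 1 + 1 < 2 * r := by omega
      simp only [shiftIn, hlt, dite_true] at e
      have hj' : (⟨j.val - 1 + 1, hlt⟩ : Fin (2 * r)) = j := Fin.ext (by simp only; omega)
      rwa [hj'] at e
  subst hP' hreg'
  rfl

/-- Re-indexing along `nextState`: `∑_σ (g (σ·0) + g (σ·1)) = 2 ∑_τ g τ`. -/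
theorem sum_nextState (g : RegState r → ℝ) :
    ∑ σ : RegState r, (g (nextState σ false) + g (nextState σ true)) = 2 * ∑ τ : RegState r, g τ := by
  have hbij := Finite.injective_iff_bijective.1 (nextState_lostBit_injective (r := r))
  calc ∑ σ : RegState r, (g (nextState σ false) + g (nextState σ true))
      = ∑ σ : RegState r, ∑ b : Bool, g (nextState σ b) :=
        sum_congr rfl fun σ _ => by rw [Fintype.sum_bool, add_comm]
    _ = ∑ σb : RegState r × Bool, g (nextState σb.1 σb.2) :=
        (Fintype.sum_prod_type' (fun (σ : RegState r) (b : Bool) => g (nextState σ b))).symm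
    _ = ∑ σb : RegState r × Bool, (fun τc : RegState r × Bool => g τc.1) (Equiv.ofBijective _ hbij σb) := rfl
    _ = ∑ τc : RegState r × Bool, (fun τc : RegState r × Bool => g τc.1) τc :=
        Equiv.sum_comp (Equiv.ofBijective _ hbij) (fun τc : RegState r × Bool => g τc.1)
    _ = ∑ τ : RegState r, ∑ _c : Bool, g τ := Fintype.sum_prod_type' (fun (τ : RegState r) (_c : Bool) => g τ)
    _ = 2 * ∑ τ : RegState r, g τ := by
        rw [mul_sum]
        exact sum_congr rfl fun τ _ => by rw [Fintype.sum_bool]; ring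

/-- The two summands of the site operator at `σ`. -/
noncomputable def brL (ε : RegState r → Bool → Bool) (f : RegState r → ℂ) (σ : RegState r) : ℂ :=
  (if ε σ false then (-1 : ℂ) else 1) * f (nextState σ false)

/-- The two summands of the site operator at `σ` (true branch, with the phase). -/
noncomputable def brR (ζ : ℂ) (ε : RegState r → Bool → Bool) (f : RegState r → ℂ) (σ : RegState r) : ℂ :=
  ζ * (if ε σ true then (-1 : ℂ) else 1) * f (nextState σ true)

/-- `siteOpR` is the average of its two branches. -/
theorem siteOpR_apply (ζ : ℂ) (ε : RegState r → Bool → Bool) (f : RegState r → ℂ) (σ : RegState r) :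
    siteOpR ζ ε f σ = (brL ε f σ + brR ζ ε f σ) / 2 := rfl

/-- The sign factors have norm `1`. -/
theorem norm_sgn (b : Bool) : ‖(if b then (-1 : ℂ) else 1)‖ = 1 := by
  cases b <;> simp

/-- Parallelogram identity for the average: `‖(a+b)/2‖² + ‖a−b‖²/4 = (‖a‖² + ‖b‖²)/2`. -/
theorem norm_avg_sq_add (a b : ℂ) : ‖(a + b) / 2‖ ^ 2 + ‖a - b‖ ^ 2 / 4 = (‖a‖ ^ 2 + ‖b‖ ^ 2) / 2 := by
  have h := parallelogram_law_with_norm ℂ a b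
  rw [norm_div, Complex.norm_two, div_pow]
  linarith

/-- **Contraction with defect**: `‖T f‖² + ¼ Σ_σ ‖brL − brR‖² ≤ ‖f‖²` for `‖ζ‖ ≤ 1`. -/
theorem rnsq_siteOpR_add_defect_le {ζ : ℂ} (hζ : ‖ζ‖ ≤ 1) (ε : RegState r → Bool → Bool) (f : RegState r → ℂ) :
    rnsq (siteOpR ζ ε f) + (∑ σ : RegState r, ‖brL ε f σ - brR ζ ε f σ‖ ^ 2) / 4 ≤ rnsq f := by
  unfold rnsq
  have hpt : ∀ σ : RegState r, ‖siteOpR ζ ε f σ‖ ^ 2 + ‖brL ε f σ - brR ζ ε f σ‖ ^ 2 / 4 ≤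
      (‖f (nextState σ false)‖ ^ 2 + ‖f (nextState σ true)‖ ^ 2) / 2 := by
    intro σ
    rw [siteOpR_apply, norm_avg_sq_add]
    have h1 : ‖brL ε f σ‖ = ‖f (nextState σ false)‖ := by
      rw [brL, norm_mul, norm_sgn, one_mul]
    have h2 : ‖brR ζ ε f σ‖ ≤ ‖f (nextState σ true)‖ := by
      rw [brR, norm_mul, norm_mul, norm_sgn, mul_one]
      exact mul_le_of_le_one_left (norm_nonneg _) hζ
    have h3 : ‖brR ζ ε f σ‖ ^ 2 ≤ ‖f (nextState σ true)‖ ^ 2 := pow_le_pow_left₀ (norm_nonneg _) h2 2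
    rw [h1]; linarith
  calc ∑ σ, ‖siteOpR ζ ε f σ‖ ^ 2 + (∑ σ, ‖brL ε f σ - brR ζ ε f σ‖ ^ 2) / 4
      = ∑ σ, (‖siteOpR ζ ε f σ‖ ^ 2 + ‖brL ε f σ - brR ζ ε f σ‖ ^ 2 / 4) := by
        rw [sum_add_distrib, sum_div]
    _ ≤ ∑ σ, (‖f (nextState σ false)‖ ^ 2 + ‖f (nextState σ true)‖ ^ 2) / 2 := sum_le_sum fun σ _ => hpt σ
    _ = ∑ τ, ‖f τ‖ ^ 2 := by
        rw [← sum_div, sum_nextState (fun τ => ‖f τ‖ ^ 2)]; ring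

/-- **P-20e stub 1 (`rnsq_siteOpR_le`) — PROVED**: every site operator is an `ℓ²`-contraction. -/
theorem rnsq_siteOpR_le {ζ : ℂ} (hζ : ‖ζ‖ ≤ 1) (ε : RegState r → Bool → Bool) (f : RegState r → ℂ) :
    rnsq (siteOpR ζ ε f) ≤ rnsq f := by
  have h := rnsq_siteOpR_add_defect_le hζ ε f
  have h0 : 0 ≤ (∑ σ : RegState r, ‖brL ε f σ - brR ζ ε f σ‖ ^ 2) / 4 := by positivity
  linarith

/-- **Rigidity of one site**: if the site operator preserves the norm of `f`, then `f` is ALIGNED at every state: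
`s₀(σ) f(σ·0) = ζ s₁(σ) f(σ·1)`. -/
theorem siteOpR_aligned_of_rnsq_eq {ζ : ℂ} (hζ : ‖ζ‖ ≤ 1) (ε : RegState r → Bool → Bool) (f : RegState r → ℂ)
    (heq : rnsq f ≤ rnsq (siteOpR ζ ε f)) (σ : RegState r) : brL ε f σ = brR ζ ε f σ := by
  have h := rnsq_siteOpR_add_defect_le hζ ε f
  have hs : ∑ τ : RegState r, ‖brL ε f τ - brR ζ ε f τ‖ ^ 2 = 0 := by
    refine le_antisymm (by linarith) (by positivity)
  have hτ := (sum_eq_zero_iff_of_nonneg fun τ _ => by positivity).1 hs σ (mem_univ _)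
  have : ‖brL ε f σ - brR ζ ε f σ‖ = 0 := by simpa using hτ
  exact sub_eq_zero.1 (norm_eq_zero.1 this)

/-- Under alignment the site operator just transports: `T f (σ) = s₀(σ) f(σ·0)`. -/
theorem siteOpR_eq_brL_of_aligned {ζ : ℂ} {ε : RegState r → Bool → Bool} {f : RegState r → ℂ} {σ : RegState r}
    (h : brL ε f σ = brR ζ ε f σ) : siteOpR ζ ε f σ = brL ε f σ := by
  rw [siteOpR_apply, ← h]; ring

/-! ## §8 Quantitative statements and the polylog-radius rung (Sketch20x §8, verbatim) -/

/-- CONJECTURE (numerics kit j297011, ROUND-19 §3): the worst block is `r`-INDEPENDENT, with block norm² `≤ (2+√3)/4`. -/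
def BlockNormUniform3 : Prop :=
  ∀ (r : ℕ) (ζ : ℂ), ζ ^ 3 = 1 → ζ ≠ 1 → ∀ (ω : Fin (2 * r) → ℂ), (∀ j, ‖ω j‖ = 1) →
    ∀ (ε : Fin (2 * r + 1) → RegState r → Bool → Bool) (f : RegState r → ℂ),
      rnsq (blockOpR ζ ω ε f) ≤ ((2 + Real.sqrt 3) / 4) * rnsq f

/-- **`TwistBoundX3LocalQ`** — quantitative `TwistBoundX3Local` (radius-uniform constants). -/
def TwistBoundX3LocalQ : Prop :=
  open scoped Classical in
  ∃ A c : ℝ, 0 < c ∧ ∀ (r N : ℕ) (t : Fin N → (Fin N → Bool) → Bool), IsLocalRule N r t →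
    ∀ γ : Fin N → ZMod 3,
      ‖∑ x : Fin N → Bool,
          (ZMod.stdAddChar (∑ i : Fin N, if x i then γ i else 0) : ℂ) *
            (if (OddZeros x ∧ RingHLF.Rel x (fun k => xor (tGuess x k) (t k x))) then (1 : ℂ) else 0)‖
        ≤ A * (64 : ℝ) ^ r *
            Real.exp (-(c * (((univ.filter fun i : Fin N => γ i ≠ 0).card : ℝ) - 4 * r) / (2 * (r : ℝ) + 1) ^ 3)) *
          (2 : ℝ) ^ N

/-- **Support `RingWindowLocalPolyLt3`** (main term, radius-uniform, on a free window of length `≥ N/(log₂ N)^C`). -/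
def RingWindowLocalPolyLt3 : Prop :=
  open scoped Classical in
  ∃ θ₀ : ℝ, θ₀ < 1 ∧ ∀ C : ℕ, ∃ n₀ : ℕ, ∀ N ≥ n₀, ∀ r ≤ Nat.log 2 N ^ C, ∀ (a L : ℕ),
    N ≤ L * Nat.log 2 N ^ C → a + L ≤ N →
    ∀ t : Fin N → (Fin N → Bool) → Bool,
      (∀ (x x' : Fin N → Bool) (k : Fin N),
          (∀ j : Fin N, (j.val < a ∨ a + L ≤ j.val) ∨ CycNear N r j k → x j = x' j) → t k x = t k x') →
        ((univ.filter fun x : Fin N → Bool =>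
            OddZeros x ∧ RingHLF.Rel x (fun k => xor (tGuess x k) (t k x))).card : ℝ)
          ≤ θ₀ * (2 : ℝ) ^ (N - 1)

/-- **RUNG CANDIDATE `RingLinFormsLocalPolyLt3`** (the join of R-lin3 and R-loc): bells = per-cut tables of
`K ≤ (log₂N)^C` linear forms of `x` mod 3 AND the radius-`r` window at the cut, `r ≤ (log₂N)^C`. -/
def RingLinFormsLocalPolyLt3 : Prop :=
  open scoped Classical in
  ∃ θ : ℝ, θ < 1 ∧ ∀ C : ℕ, ∃ n₀ : ℕ, ∀ N ≥ n₀, ∀ r ≤ Nat.log 2 N ^ C, ∀ K ≤ Nat.log 2 N ^ C,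
    ∀ (lam : Fin K → Fin N → ZMod 3) (tab : Fin N → (Fin K → ZMod 3) → (Fin N → Bool) → Bool),
      (∀ v : Fin K → ZMod 3, IsLocalRule N r (fun k x => tab k v x)) →
        ((univ.filter fun x : Fin N → Bool =>
            OddZeros x ∧ RingHLF.Rel x (fun k => xor (tGuess x k) (tab k (LinForms.resVec lam x) x))).card : ℝ)
          ≤ θ * (2 : ℝ) ^ (N - 1)

/-! ## §9 The bottom of the degree ladder (Sketch20x §9, verbatim) -/

/-- **CONJECTURE / RUNG TARGET `RingAffineBellsLt3`** — affine MOD₃ bells lose a constant fraction of the odd class. -/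
def RingAffineBellsLt3 : Prop :=
  open scoped Classical in
  ∃ θ : ℝ, θ < 1 ∧ ∃ n₀ : ℕ, ∀ N ≥ n₀, ∀ (β : Fin N → Fin N → ZMod 3) (c : Fin N → ZMod 3),
    ((univ.filter fun x : Fin N → Bool =>
        OddZeros x ∧ RingHLF.Rel x (fun k => decide ((∑ i : Fin N, if x i then β k i else 0) = c k))).card : ℝ)
      ≤ θ * (2 : ℝ) ^ (N - 1)

end BondTwist3

end Summit.QuantumAdvantage.AdviceFreeQNC0
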